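import Literature.AlgebraicGeometry.Frobenioids.Thm34Sub
import Literature.AlgebraicGeometry.Frobenioids.EquivalenceRigidComposites
import Literature.AlgebraicGeometry.Frobenioids.PerfectionRigidity
import HarnessLib

/-!
# Frobenioids I, Theorem 3.4 sub-DAG: closers of `Thm34Sub` slots, tranche 1 (rigidity triplet)

Mochizuki, *The geometry of Frobenioids I*, Kyushu J. Math. **62** (2008), Thm. 3.4 pp. 62–63
[cite: MochizukiFrdI2008, Thm. 3.4 pp.62-63].

PROOF-ONLY file (abc-iut-L1-d8 = sole writer of the `Thm34Sub` closers, abc-iut-L1-lead R70 (2)): each slot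
`FrdI.Thm34Sub.<Decl>` of the statements file is closed by a one-line term over a landed piece.
Tranche 1 = the rigidity triplet ("if `D₁, D₂` are slim, each composite functor of the diagram is rigid",
Prop. 1.13): `L02_RigidityOfPfComposites` (abc-iut-w4-d090 `PerfectionRigidity`), `L11_UntrRigidity` and
`L14_BaseRigidity` (abc-iut-w4-d090 `EquivalenceRigidComposites`).
-/

namespace Literature.AlgebraicGeometry.Frobenioids

namespace FrdI

namespace Thm34Sub

open CategoryTheory PreFrobenioidData

universe w v v' u u'

variable {D₁ : Type u} [Category.{v} D₁] {Φ₁ : D₁ᵒᵖ ⥤ CommMonCat.{w}} {C₁ : Type u'} [Category.{v'} C₁]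
  {D₂ : Type u} [Category.{v} D₂] {Φ₂ : D₂ᵒᵖ ⥤ CommMonCat.{w}} {C₂ : Type u'} [Category.{v'} C₂]
  (F₁ : C₁ ⥤ ElemFrobenioid Φ₁) (F₂ : C₂ ⥤ ElemFrobenioid Φ₂) (Ψ : C₁ ≌ C₂)

/-- **SLOT (iii)/L02 `RigidityOfPfComposites` — CLOSED**: `C₁ → C₂ → C₂^pf` is rigid because `C₂ → C₂^pf` is
(abc-iut-w4-d090 `PreFrobenioid.isRigidFunctor_toPf`, standard type ⊇ Frobenius-normalized) and
`Ψ` is an equivalence; `C₁ → C₁^pf → C₂^pf` is rigid by transport along the `1`-commuting isomorphism.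
[cite: MochizukiFrdI2008, Thm. 3.4 (iii) p.63] -/
theorem l02_rigidityOfPfComposites_holds :
    Literature.AlgebraicGeometry.Frobenioids.FrdI.Thm34Sub.L02_RigidityOfPfComposites F₁ F₂ Ψ := by
  intro hF₁ hF₂ h _ hD₂ Ψpf hsq
  obtain ⟨η⟩ := hsq
  have h1 : IsRigidFunctor (Ψ.functor ⋙ PreFrobenioid.Perfection.toPf hF₂) :=
    IsRigidFunctor.comp_of_isEquivalence Ψ.functor
      (PreFrobenioid.isRigidFunctor_toPf hF₂ hD₂ h.standard₂.frobeniusNormalized)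
  exact ⟨h1, PreFrobenioidData.isRigidFunctor_congr η h1⟩

/-- **SLOT (iv)/L11 `UntrRigidity` — CLOSED** (abc-iut-w4-d090 `PreFrobenioid.thm34iv_untr_rigidity`, p411882).
[cite: MochizukiFrdI2008, Thm. 3.4 (iv) p.63] -/
theorem l11_untrRigidity_holds :
    Literature.AlgebraicGeometry.Frobenioids.FrdI.Thm34Sub.L11_UntrRigidity F₁ F₂ Ψ :=
  fun h _ hD₂ E Ψuntr hsq => PreFrobenioid.thm34iv_untr_rigidity h.isFrobenioid₂ hD₂ E.functor Ψuntr hsq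

/-- **SLOT (v)/L14 `BaseRigidity` — CLOSED** (abc-iut-w4-d090 `PreFrobenioid.thm34v_rigidity`, p411882).
[cite: MochizukiFrdI2008, Thm. 3.4 (v) p.63] -/
theorem l14_baseRigidity_holds :
    Literature.AlgebraicGeometry.Frobenioids.FrdI.Thm34Sub.L14_BaseRigidity F₁ F₂ Ψ :=
  fun h _ hD₂ ΨBase hsq => PreFrobenioid.thm34v_rigidity h.isFrobenioid₂ hD₂ Ψ ΨBase hsq

end Thm34Sub

end FrdI

end Literature.AlgebraicGeometry.Frobenioids
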